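import Literature.AlgebraicGeometry.HodgeTheory.DiagonalSymmetry
import Literature.AlgebraicGeometry.Motives.SegreEmbedding
import Mathlib.Algebra.MvPolynomial.Expand
import HarnessLib

/-!
# The power map `[x₀ : … : x_{n+1}] ↦ [x₀ᵏ : … : x_{n+1}ᵏ]` of projective space

Family `hodge`, layer `Literature/AlgebraicGeometry/HodgeTheory`. For a commutative ring `R`, an index
type `ι` and `k ≥ 1`, the **power map** `Proj R[xᵢ : i ∈ ι] → Proj R[xᵢ : i ∈ ι]`, `[x] ↦ [xᵏ]`, is the
morphism of `Proj` attached to the substitution `φ : xᵢ ↦ xᵢᵏ` (Hartshorne II Ex. 2.14; EGA II 2.8).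
Since `φ` multiplies degrees by `k`, it is not a graded homomorphism for the standard gradings and
Mathlib's functoriality `AlgebraicGeometry.Proj.map` does not apply; the morphism is constructed here
by GLUING over the standard charts (Mathlib `Scheme.Cover.glueMorphisms`, `Proj.pullbackAwayιIso`),
exactly as the Segre map of `Motives/SegreEmbedding`:

* `ProjPowerMap.scaleMap` — the **degree-scaling map of homogeneous localizations** `A⁰_P → B⁰_Q`,
  `a/s ↦ φ(a)/φ(s)`, for any ring map `φ : A → B` with `φ(𝒜ᵢ) ⊆ ℬ_{k i}` and `φ(P) ⊆ Q` (the
  `k = 1` case is Mathlib's `HomogeneousLocalization.map`); `ProjPowerMap.powerAway` — its instance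
  `(R[x]_{(f)})₀ → (R[x]_{(φ f)})₀` for `φ = (xᵢ ↦ xᵢᵏ)` (Mathlib `MvPolynomial.expand k`), with
  `powerAway (a/fᵐ) = φ(a)/(φ f)ᵐ` (`powerAway_awayMk`), compatible with the structure maps
  (`powerAway_comp_cst`) and with the restriction maps `(R[x]_{(f)})₀ → (R[x]_{(fh)})₀`
  (`powerAway_comp_awayMap`);
* `ProjPowerMap.powChart i : Spec (R[x]_{(xᵢᵏ)})₀ → D₊(xᵢ) ⊆ Proj R[x]` — the chart maps,
  `x_j/x_i ↦ x_jᵏ/x_iᵏ`, which agree on `D₊(xᵢᵏ) ×_{Proj} D₊(xⱼᵏ) = D₊(xᵢᵏ xⱼᵏ)`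
  (`powChart_compatible`: both are `Spec` of `(R[x]_{(xᵢxⱼ)})₀ → (R[x]_{(xᵢᵏxⱼᵏ)})₀` followed by
  `D₊(xᵢxⱼ) ⊆ Proj`), and glue to **`ProjPowerMap.powerMap ι R hk : Proj R[x] ⟶ Proj R[x]`**, a
  morphism over `Spec R` (`powerMap_toSpec`) with **`powerMap ⁻¹ D₊(G) = D₊(φ G)`** for every
  homogeneous `G` of positive degree (`powerMap_preimage_basicOpen`);
* over `ℂ`: `projPowerMap n hk : ℙⁿ⁺¹_ℂ ⟶ ℙⁿ⁺¹_ℂ` in `SchemeOver ℂ` and the **points formula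
  `map_projPowerMap_projPoint`: `[v] ↦ [(vᵢᵏ)ᵢ]` on complex points** (both lie in the same basic opens,
  `[v] ∈ D₊(φ G) ↔ G(vᵏ) ≠ 0`, as for `CoordinateEmbedding.map_coordProjEmb_projPoint`).

The restriction to the Fermat hypersurfaces, `Xⁿ_{km} → Xⁿₘ` (Shioda–Katsura 1979 §1), is the sequel
`HodgeTheory/FermatLevelMap`. Everything is PROVED; no named facts.

## References

* [Hartshorne1977] R. Hartshorne, *Algebraic Geometry*, GTM 52 (1977), II Ex. 2.14, II Prop. 2.5.
* [EGAII] A. Grothendieck, *Éléments de géométrie algébrique II*, Publ. Math. IHÉS 8 (1961), (2.8).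
-/

noncomputable section

open CategoryTheory AlgebraicGeometry MvPolynomial HomogeneousLocalization Limits

universe u

namespace Literature.AlgebraicGeometry.HodgeTheory

namespace ProjPowerMap

/-! ### Degree-scaling ring maps on homogeneous localizations -/

section ScaleMap

variable {A B σA σB : Type*} [CommRing A] [CommRing B] [SetLike σA A] [SetLike σB B]
  {𝒜 : ℕ → σA} {ℬ : ℕ → σB} (φ : A →+* B) (k : ℕ)
  (hφ : ∀ ⦃i : ℕ⦄ ⦃a : A⦄, a ∈ 𝒜 i → φ a ∈ ℬ (k * i))
  {P : Submonoid A} {Q : Submonoid B} (hPQ : P ≤ Q.comap φ)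

/-- Numerator-denominator pairs along a ring map `φ` with `φ(𝒜ᵢ) ⊆ ℬ_{k i}`: `(a, s) ↦ (φ a, φ s)`,
of degree `k · deg`. [folklore] -/
def scaleNumDen (c : NumDenSameDeg 𝒜 P) : NumDenSameDeg ℬ Q :=
  ⟨k * c.deg, ⟨φ c.num, hφ c.num.2⟩, ⟨φ c.den, hφ c.den.2⟩, hPQ c.den_mem⟩

/-- The fraction of `scaleNumDen c` is the image of the fraction of `c` under the map of
localizations induced by `φ`. [folklore] -/
theorem embedding_scaleNumDen (c : NumDenSameDeg 𝒜 P) :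
    (scaleNumDen φ k hφ hPQ c).embedding = IsLocalization.map (Localization Q) φ hPQ c.embedding := by
  simp only [NumDenSameDeg.embedding, scaleNumDen, Localization.mk_eq_mk', IsLocalization.map_mk']

/-- The degree-scaling map on homogeneous localizations, as a bare function. [folklore] -/
def scaleFun : HomogeneousLocalization 𝒜 P → HomogeneousLocalization ℬ Q :=
  Quotient.map' (scaleNumDen φ k hφ hPQ) fun x y (e : x.embedding = y.embedding) ↦ by
    change (scaleNumDen φ k hφ hPQ x).embedding = (scaleNumDen φ k hφ hPQ y).embedding
    rw [embedding_scaleNumDen, embedding_scaleNumDen, e]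

/-- `scaleFun` is, on values in the localizations, the map induced by `φ`. [folklore] -/
theorem val_scaleFun (q : HomogeneousLocalization 𝒜 P) :
    (scaleFun φ k hφ hPQ q).val = IsLocalization.map (Localization Q) φ hPQ q.val := by
  obtain ⟨c, rfl⟩ := mk_surjective q
  exact embedding_scaleNumDen φ k hφ hPQ c

variable [AddSubgroupClass σA A] [AddSubgroupClass σB B] [GradedRing 𝒜] [GradedRing ℬ]

/-- **The degree-scaling map of homogeneous localizations** `A⁰_P → B⁰_Q`, `a/s ↦ φ(a)/φ(s)`, induced
by a ring map `φ : A → B` with `φ(𝒜ᵢ) ⊆ ℬ_{k i}` and `φ(P) ⊆ Q` (for `k = 1` this is Mathlib's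
`HomogeneousLocalization.map`; degree-`0` fractions go to degree-`0` fractions since `φ`
multiplies all degrees by `k`). [folklore] -/
def scaleMap : HomogeneousLocalization 𝒜 P →+* HomogeneousLocalization ℬ Q where
  toFun := scaleFun φ k hφ hPQ
  map_one' := val_injective _ (by rw [val_scaleFun, val_one, val_one, map_one])
  map_mul' a b := val_injective _ (by
    rw [val_scaleFun, val_mul, val_mul, map_mul, val_scaleFun, val_scaleFun])
  map_zero' := val_injective _ (by rw [val_scaleFun, val_zero, val_zero, map_zero])
  map_add' a b := val_injective _ (by
    rw [val_scaleFun, val_add, val_add, map_add, val_scaleFun, val_scaleFun])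

/-- `scaleMap` on values. [folklore] -/
theorem val_scaleMap (q : HomogeneousLocalization 𝒜 P) :
    (scaleMap φ k hφ hPQ q).val = IsLocalization.map (Localization Q) φ hPQ q.val :=
  val_scaleFun φ k hφ hPQ q

/-- `scaleMap (a/s) = φ(a)/φ(s)` (`rfl`). [folklore] -/
theorem scaleMap_mk (c : NumDenSameDeg 𝒜 P) :
    scaleMap φ k hφ hPQ (mk c) = mk (scaleNumDen φ k hφ hPQ c) := rfl

/-- The value of `scaleMap (a/s)` in `B_Q` is `φ(a)/φ(s)` (`rfl`). [folklore] -/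
theorem val_scaleMap_mk (c : NumDenSameDeg 𝒜 P) :
    (scaleMap φ k hφ hPQ (mk c)).val = Localization.mk (φ c.num) ⟨φ c.den, hPQ c.den_mem⟩ := rfl

end ScaleMap

/-! ### The substitution `xᵢ ↦ xᵢᵏ` and its chart ring maps -/

section Expand

open Literature.AlgebraicGeometry.Motives.Segre

attribute [local instance] MvPolynomial.gradedAlgebra

variable {ι : Type} (R : Type u) [CommRing R] (k : ℕ)

/-- The grading of `R[xᵢ : i ∈ ι]` by degree (local notation). [folklore] -/
local notation "𝓐" => MvPolynomial.homogeneousSubmodule ι R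

/-- The substitution `φ : xᵢ ↦ xᵢᵏ` as a ring endomorphism of `R[xᵢ : i ∈ ι]` (Mathlib
`MvPolynomial.expand k`). [folklore] -/
abbrev expandHom : MvPolynomial ι R →+* MvPolynomial ι R :=
  (expand k : MvPolynomial ι R →ₐ[R] MvPolynomial ι R).toRingHom

/-- `expandHom R k a = expand k a` (`rfl`). [folklore] -/
@[simp]
theorem expandHom_apply (a : MvPolynomial ι R) : expandHom R k a = expand k a := rfl

/-- `xᵢ ↦ xᵢᵏ` multiplies degrees by `k`. [folklore] -/
theorem expand_mem {i : ℕ} {a : MvPolynomial ι R} (ha : a ∈ 𝓐 i) :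
    (expand k a : MvPolynomial ι R) ∈ 𝓐 (k * i) := by
  rw [mem_homogeneousSubmodule] at ha ⊢
  exact ha.aeval _ fun j ↦ by simpa using (isHomogeneous_X R j).pow k

/-- `xᵢᵏ` is homogeneous of degree `k`. [folklore] -/
theorem pow_X_mem (i : ι) : (X i : MvPolynomial ι R) ^ k ∈ 𝓐 k := by
  simpa using SetLike.pow_mem_graded k (X_mem R i)

variable {R k}

/-- `φ = (xᵢ ↦ xᵢᵏ)` maps the powers of `f` into the powers of `g = φ f`. [folklore] -/
theorem powers_le_comap {f g : MvPolynomial ι R} (hfg : expand k f = g) :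
    Submonoid.powers f ≤ (Submonoid.powers g).comap (expandHom R k) := by
  rintro _ ⟨m, rfl⟩
  exact ⟨m, by simp [← hfg, map_pow]⟩

/-- **The chart ring map of the power map**: `(R[x]_{(f)})₀ → (R[x]_{(g)})₀`, `a/fᵐ ↦ φ(a)/gᵐ`, for
`φ = (xᵢ ↦ xᵢᵏ)` and `φ f = g` (e.g. `f = xᵢ`, `g = xᵢᵏ`: `x_j/x_i ↦ x_jᵏ/x_iᵏ`). [folklore] -/
def powerAway {f g : MvPolynomial ι R} (hfg : expand k f = g) : Away 𝓐 f →+* Away 𝓐 g :=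
  scaleMap (expandHom R k) k (fun _ _ h ↦ expand_mem R k h) (powers_le_comap hfg)

/-- `powerAway` on values is the map of localizations `R[x]_f → R[x]_g` induced by `φ`. [folklore] -/
theorem val_powerAway {f g : MvPolynomial ι R} (hfg : expand k f = g) (q : Away 𝓐 f) :
    (powerAway hfg q).val =
      IsLocalization.map (Localization.Away g) (expandHom R k) (powers_le_comap hfg) q.val :=
  val_scaleMap _ _ _ _ q

/-- The value of `powerAway (a/fᵐ)` is `φ(a)/gᵐ`. [folklore] -/
theorem val_powerAway_awayMk {f g : MvPolynomial ι R} (hfg : expand k f = g) {d : ℕ} (hf : f ∈ 𝓐 d)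
    (m : ℕ) (a : MvPolynomial ι R) (ha : a ∈ 𝓐 (m • d)) :
    (powerAway hfg (Away.mk 𝓐 hf m a ha)).val =
      Localization.mk (expand k a : MvPolynomial ι R) (⟨g ^ m, ⟨m, rfl⟩⟩ : Submonoid.powers g) := by
  rw [val_powerAway, Away.val_mk, Localization.mk_eq_mk', IsLocalization.map_mk', ← Localization.mk_eq_mk']
  congr 1
  exact Subtype.ext (by simp [map_pow, hfg])

/-- `powerAway (a/fᵐ) = φ(a)/gᵐ` as homogeneous fractions. [folklore] -/
theorem powerAway_awayMk {f g : MvPolynomial ι R} (hfg : expand k f = g) {d : ℕ} (hf : f ∈ 𝓐 d)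
    (hg : g ∈ 𝓐 (k * d)) (m : ℕ) (a : MvPolynomial ι R) (ha : a ∈ 𝓐 (m • d)) :
    powerAway hfg (Away.mk 𝓐 hf m a ha) = Away.mk 𝓐 hg m (expand k a) (by
      rw [smul_eq_mul, Nat.mul_left_comm]; exact expand_mem R k ha) := by
  apply val_injective
  rw [val_powerAway_awayMk, Away.val_mk]

/-- `powerAway` is an `R`-algebra map: it commutes with the structure maps `cst`. [folklore] -/
theorem powerAway_comp_cst {f g : MvPolynomial ι R} (hfg : expand k f = g) :
    (powerAway hfg).comp (cst R f) = cst R g := by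
  refine RingHom.ext fun c ↦ val_injective _ ?_
  rw [RingHom.comp_apply, val_powerAway, val_cst, val_cst, IsLocalization.map_eq]
  exact congrArg _ (expand_C k c)

/-- **Compatibility of the chart ring maps with the restriction maps** `(R[x]_{(f)})₀ → (R[x]_{(fh)})₀`
(Mathlib `HomogeneousLocalization.awayMap`): `φ(a hᵐ)/φ(f h)ᵐ = φ(a) φ(h)ᵐ / (φ f φ h)ᵐ`. [folklore] -/
theorem powerAway_comp_awayMap {d e : ℕ} {f h x f' h' x' : MvPolynomial ι R}
    (hf : f ∈ 𝓐 d) (hh : h ∈ 𝓐 e) (hx : x = f * h) (hff' : expand k f = f') (hhh' : expand k h = h')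
    (hxx' : expand k x = x') {e' : ℕ} (hh' : h' ∈ 𝓐 e') (hx' : x' = f' * h') :
    (powerAway hxx').comp (awayMap 𝓐 hh hx) = (awayMap 𝓐 hh' hx').comp (powerAway hff') := by
  have hf' : f' ∈ 𝓐 (k * d) := hff' ▸ expand_mem R k hf
  refine RingHom.ext fun q ↦ ?_
  obtain ⟨m, a, ha, rfl⟩ := Away.mk_surjective 𝓐 hf q
  apply val_injective
  rw [RingHom.comp_apply, RingHom.comp_apply, awayMap_mk, val_powerAway_awayMk,
    powerAway_awayMk hff' hf hf', awayMap_mk, Away.val_mk]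
  congr 1
  rw [map_mul, map_pow, hhh']

end Expand

/-! ### The power map of `Proj R[xᵢ : i ∈ ι]`, glued over the charts `D₊(xᵢᵏ)` -/

section PowerMap

open Literature.AlgebraicGeometry.Motives.Segre

attribute [local instance] MvPolynomial.gradedAlgebra

variable (ι : Type) (R : Type u) [CommRing R] {k : ℕ} (hk : 0 < k)

/-- The grading of `R[xᵢ : i ∈ ι]` by degree (local notation). [folklore] -/
local notation "𝓐" => MvPolynomial.homogeneousSubmodule ι R

/-- The open cover of `Proj R[x]` by the charts `D₊(xᵢᵏ) = Spec (R[x]_{(xᵢᵏ)})₀` (`= D₊(xᵢ)`), the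
source charts of the power map. [folklore] -/
def powCover : (Proj 𝓐).OpenCover :=
  Scheme.Cover.mkOfCovers ι (fun i ↦ Spec (.of (Away 𝓐 ((X i : MvPolynomial ι R) ^ k))))
    (fun i ↦ Proj.awayι 𝓐 (X i ^ k) (pow_X_mem R k i) hk) (by
      intro x
      have hx : x ∈ (⊤ : (Proj 𝓐).Opens) := trivial
      rw [← Proj.iSup_basicOpen_eq_top 𝓐 (fun i : ι ↦ (X i : MvPolynomial ι R))
        (irrelevant_le_span_X ι R), TopologicalSpace.Opens.mem_iSup] at hx
      obtain ⟨i, hi⟩ := hx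
      rw [← Proj.basicOpen_pow 𝓐 _ k hk, ← Proj.opensRange_awayι 𝓐 _ (pow_X_mem R k i) hk] at hi
      obtain ⟨y, hy⟩ := hi
      exact ⟨i, y, hy⟩)

/-- The maps of `powCover` are the chart immersions `Spec (R[x]_{(xᵢᵏ)})₀ → Proj R[x]` (`rfl`).
[folklore] -/
theorem powCover_f (i : ι) :
    (powCover ι R hk).f i = Proj.awayι 𝓐 (X i ^ k) (pow_X_mem R k i) hk := rfl

/-- **The power map on the chart `D₊(xᵢᵏ)`**: `Spec (R[x]_{(xᵢᵏ)})₀ → Spec (R[x]_{(xᵢ)})₀ = D₊(xᵢ) ⊆ Proj R[x]`,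
`Spec` of `x_j/x_i ↦ x_jᵏ/x_iᵏ`. [folklore] -/
def powChart (i : ι) : Spec (.of (Away 𝓐 ((X i : MvPolynomial ι R) ^ k))) ⟶ Proj 𝓐 :=
  Spec.map (CommRingCat.ofHom (powerAway (expand_X k i : expand k (X i : MvPolynomial ι R) = X i ^ k))) ≫
    chartι R i

variable {ι R} in
/-- `φ(xᵢ xⱼ) = xᵢᵏ xⱼᵏ`. [folklore] -/
theorem expand_X_mul_X (i j : ι) :
    expand k ((X i : MvPolynomial ι R) * X j) = X i ^ k * X j ^ k := by
  rw [map_mul, expand_X, expand_X]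

/-- **The chart maps agree on the overlaps** `D₊(xᵢᵏ) ×_{Proj} D₊(xⱼᵏ) = D₊(xᵢᵏ xⱼᵏ)` (Mathlib
`Proj.pullbackAwayιIso`): both are `Spec` of `(R[x]_{(xᵢxⱼ)})₀ → (R[x]_{(xᵢᵏxⱼᵏ)})₀`, `a/(xᵢxⱼ)ᵐ ↦ φ(a)/(xᵢᵏxⱼᵏ)ᵐ`,
followed by `D₊(xᵢ xⱼ) ⊆ Proj R[x]`. [folklore] -/
theorem powChart_compatible (i j : ι) :
    pullback.fst (Proj.awayι 𝓐 (X i ^ k) (pow_X_mem R k i) hk) (Proj.awayι 𝓐 (X j ^ k) (pow_X_mem R k j) hk) ≫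
        powChart ι R i =
      pullback.snd _ _ ≫ powChart ι R j := by
  refine (cancel_epi (Proj.pullbackAwayιIso 𝓐 (pow_X_mem R k i) hk (pow_X_mem R k j) hk
      (x := X i ^ k * X j ^ k) rfl).inv).mp ?_
  rw [Proj.pullbackAwayιIso_inv_fst_assoc, Proj.pullbackAwayιIso_inv_snd_assoc, powChart, powChart,
    ← Spec.map_comp_assoc, ← Spec.map_comp_assoc, ← CommRingCat.ofHom_comp, ← CommRingCat.ofHom_comp,
    ← powerAway_comp_awayMap (X_mem R i) (X_mem R j) rfl (expand_X k i) (expand_X k j)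
      (expand_X_mul_X i j) (pow_X_mem R k j) rfl,
    ← powerAway_comp_awayMap (X_mem R j) (X_mem R i) (mul_comm (X i) (X j)) (expand_X k j)
      (expand_X k i) (expand_X_mul_X i j) (pow_X_mem R k i) (mul_comm _ _),
    CommRingCat.ofHom_comp, CommRingCat.ofHom_comp, Spec.map_comp_assoc, Spec.map_comp_assoc]
  show _ ≫ _ ≫ Proj.awayι 𝓐 (X i) (X_mem R i) zero_lt_one = _ ≫ _ ≫ Proj.awayι 𝓐 (X j) (X_mem R j) zero_lt_one
  rw [Proj.SpecMap_awayMap_awayι 𝓐 (X_mem R i) zero_lt_one (X_mem R j) (rfl : X i * X j = X i * X j),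
    Proj.SpecMap_awayMap_awayι 𝓐 (X_mem R j) zero_lt_one (X_mem R i) (mul_comm (X i) (X j))]

/-- **The power map `[x] ↦ [xᵏ]` of `Proj R[xᵢ : i ∈ ι]`** (`k ≥ 1`), glued from the chart maps
`D₊(xᵢᵏ) → D₊(xᵢ)`, `x_j/x_i ↦ x_jᵏ/x_iᵏ` (Mathlib `Scheme.Cover.glueMorphisms`). On homogeneous
coordinate rings it is the substitution `xᵢ ↦ xᵢᵏ`, which multiplies degrees by `k` and is therefore
outside the scope of Mathlib's `Proj.map`. [cite: Hartshorne1977, II Ex. 2.14] -/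
def powerMap : Proj 𝓐 ⟶ Proj 𝓐 :=
  (powCover ι R hk).glueMorphisms (fun i ↦ powChart ι R i) fun i j ↦ powChart_compatible ι R hk i j

/-- On the chart `D₊(xᵢᵏ)` the power map is the chart map. [folklore] -/
@[reassoc]
theorem awayι_comp_powerMap (i : ι) :
    Proj.awayι 𝓐 (X i ^ k) (pow_X_mem R k i) hk ≫ powerMap ι R hk = powChart ι R i :=
  (powCover ι R hk).ι_glueMorphisms _ _ i

/-- A chart `D₊(f) = Spec (R[x]_{(f)})₀ → Proj R[x] → Spec R` is `Spec` of the structure map of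
`(R[x]_{(f)})₀` (Mathlib `Proj.awayι_toSpecZero`). [folklore] -/
theorem awayι_toSpec {d : ℕ} {f : MvPolynomial ι R} (hf : f ∈ 𝓐 d) (hd : 0 < d) :
    Proj.awayι 𝓐 f hf hd ≫ toSpec ι R = Spec.map (CommRingCat.ofHom (cst R f)) := by
  rw [toSpec, Proj.awayι_toSpecZero_assoc, ← Spec.map_comp, ← CommRingCat.ofHom_comp]
  rfl

/-- The chart maps of the power map are morphisms over `Spec R`. [folklore] -/
theorem powChart_toSpec (i : ι) :
    powChart ι R i ≫ toSpec ι R = Proj.awayι 𝓐 (X i ^ k) (pow_X_mem R k i) hk ≫ toSpec ι R := by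
  rw [powChart, Category.assoc, chartι_toSpec, ← Spec.map_comp, ← CommRingCat.ofHom_comp,
    powerAway_comp_cst, awayι_toSpec]

/-- **The power map is a morphism over `Spec R`.** [folklore] -/
theorem powerMap_toSpec : powerMap ι R hk ≫ toSpec ι R = toSpec ι R :=
  Scheme.Cover.hom_ext (powCover ι R hk) _ _ fun (i : ι) ↦ by
    show Proj.awayι 𝓐 (X i ^ k) (pow_X_mem R k i) hk ≫ powerMap ι R hk ≫ toSpec ι R =
      Proj.awayι 𝓐 (X i ^ k) (pow_X_mem R k i) hk ≫ toSpec ι R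
    rw [awayι_comp_powerMap_assoc, powChart_toSpec]

variable {ι R} in
/-- On `(R[x]_{(xᵢᵏ)})₀`: `(φ G)ᵏ/(xᵢᵏ)^{k d} = (φ(G)/xᵢ^{k d})ᵏ` — the localization elements cutting
out `D₊(φ G)` and `D₊(G)` in the charts `D₊(xᵢᵏ)` and `D₊(xᵢ)` differ by a `k`-th power. [folklore] -/
theorem isLocalizationElem_expand (i : ι) {d : ℕ} {G : MvPolynomial ι R} (hG : G ∈ 𝓐 d) :
    Away.isLocalizationElem (pow_X_mem R k i) (expand_mem R k hG) =
      powerAway (expand_X k i) (Away.isLocalizationElem (X_mem R i) hG) ^ k := by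
  apply val_injective
  rw [val_pow, Away.isLocalizationElem, Away.isLocalizationElem, Away.val_mk, val_powerAway_awayMk,
    Localization.mk_pow, Localization.mk_eq_mk_iff, Localization.r_iff_exists]
  refine ⟨1, ?_⟩
  simp only [OneMemClass.coe_one, one_mul, SubmonoidClass.coe_pow, pow_one]
  ring

/-- **The power map pulls `D₊(G)` back to `D₊(φ G)`**, `φ G = G(x₀ᵏ, …)`, for `G` homogeneous of
positive degree (checked on the charts `D₊(xᵢᵏ)`, where both are the basic open of `φ(G)/xᵢ^{k deg G}`).
[folklore] -/
theorem powerMap_preimage_basicOpen {d : ℕ} (hd : 0 < d) {G : MvPolynomial ι R} (hG : G ∈ 𝓐 d) :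
    powerMap ι R hk ⁻¹ᵁ Proj.basicOpen 𝓐 G = Proj.basicOpen 𝓐 (expand k G) := by
  refine opens_ext_of_openCover (powCover ι R hk) _ _ fun (i : ι) ↦ ?_
  show Proj.awayι 𝓐 (X i ^ k) (pow_X_mem R k i) hk ⁻¹ᵁ (powerMap ι R hk ⁻¹ᵁ Proj.basicOpen 𝓐 G) =
    Proj.awayι 𝓐 (X i ^ k) (pow_X_mem R k i) hk ⁻¹ᵁ Proj.basicOpen 𝓐 (expand k G)
  rw [← Scheme.Hom.comp_preimage, awayι_comp_powerMap, powChart,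
    Scheme.Hom.comp_preimage, Proj.awayι_preimage_basicOpen _ (X_mem R i) zero_lt_one hG hd,
    SpecMap_preimage_basicOpen,
    Proj.awayι_preimage_basicOpen _ (pow_X_mem R k i) hk (expand_mem R k hG) (Nat.mul_pos hk hd),
    isLocalizationElem_expand i hG, PrimeSpectrum.basicOpen_pow _ k hk]
  rfl

end PowerMap

end ProjPowerMap

/-! ### The power map of `ℙⁿ⁺¹_ℂ` over `ℂ` and its complex points -/

section Complex

open Literature.AlgebraicGeometry.Motives Literature.NumberTheory.Transcendental ProjPowerMap

attribute [local instance] MvPolynomial.gradedAlgebra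

variable {n k : ℕ}

/-- The grading of `ℂ[x₀, …, x_{n+1}]` by degree (local notation). [folklore] -/
local notation "𝓐" => MvPolynomial.homogeneousSubmodule (Fin (n + 2)) ℂ

variable (n) in
/-- **The power map `ℙⁿ⁺¹_ℂ → ℙⁿ⁺¹_ℂ`, `[x₀ : … : x_{n+1}] ↦ [x₀ᵏ : … : x_{n+1}ᵏ]`, over `ℂ`** (`k ≥ 1`),
a morphism in `SchemeOver ℂ = Over (Spec ℂ)`. [cite: Hartshorne1977, II Ex. 2.14] -/
def projPowerMap (hk : 0 < k) : Motives.projectiveSpace (n + 1) ℂ ⟶ Motives.projectiveSpace (n + 1) ℂ :=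
  Over.homMk (powerMap (Fin (n + 2)) ℂ hk) (powerMap_toSpec (Fin (n + 2)) ℂ hk)

/-- The underlying morphism of `projPowerMap n hk` is `powerMap` (`rfl`). [folklore] -/
@[simp]
theorem projPowerMap_left (hk : 0 < k) : (projPowerMap n hk).left = powerMap (Fin (n + 2)) ℂ hk := rfl

/-- `projPowerMap` pulls `D₊(G)` back to `D₊(φ G)` for `G` homogeneous of positive degree. [folklore] -/
theorem projPowerMap_preimage_basicOpen (hk : 0 < k) {d : ℕ} (hd : 0 < d)
    {G : MvPolynomial (Fin (n + 2)) ℂ} (hG : G ∈ 𝓐 d) :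
    (projPowerMap n hk).left ⁻¹ᵁ Proj.basicOpen 𝓐 G = Proj.basicOpen 𝓐 (expand k G) :=
  powerMap_preimage_basicOpen _ _ hk hd hG

/-- `(vᵢᵏ)ᵢ ≠ 0` for `v ≠ 0`. [folklore] -/
theorem pow_vec_ne_zero {v : Fin (n + 2) → ℂ} (hv : v ≠ 0) (k : ℕ) : (fun i ↦ v i ^ k) ≠ 0 := by
  obtain ⟨i, hi⟩ := Function.ne_iff.mp hv
  exact Function.ne_iff.mpr ⟨i, pow_ne_zero k hi⟩

/-- **On complex points the power map is `[v] ↦ [(vᵢᵏ)ᵢ]`**: the `ℂ`-point with homogeneous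
coordinates `v` goes to the `ℂ`-point with homogeneous coordinates `(vᵢᵏ)ᵢ` (both lie in the same
basic opens: `[v] ∈ D₊(φ G) ↔ (φ G)(v) ≠ 0 ↔ G(vᵏ) ≠ 0`). [cite: Hartshorne1977, II Ex. 2.14] -/
theorem map_projPowerMap_projPoint (hk : 0 < k) (v : Fin (n + 2) → ℂ) (hv : v ≠ 0) :
    AlgPoints.map (projPowerMap n hk) (projPoint (n + 1) (Projectivization.mk ℂ v hv)) =
      projPoint (n + 1) (Projectivization.mk ℂ (fun i ↦ v i ^ k) (pow_vec_ne_zero hv k)) := by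
  refine ComplexPoints.ext_of_pt_eq ?_
  rw [AlgPoints.pt_map, projPoint_mk, projPoint_mk]
  refine Proj.ext_of_forall_mem_basicOpen_iff 𝓐 fun m hm f hf ↦ ?_
  change (pointOfVec (n + 1) v hv).pt ∈ (projPowerMap n hk).left ⁻¹ᵁ Proj.basicOpen 𝓐 f ↔ _
  rw [projPowerMap_preimage_basicOpen hk hm hf]
  refine (pt_pointOfVec_mem_basicOpen_iff (n + 1) v hv (Nat.mul_pos hk hm) (expand_mem ℂ k hf)).trans ?_
  rw [eval_expand]
  exact (pt_pointOfVec_mem_basicOpen_iff (n + 1) _ (pow_vec_ne_zero hv k) hm hf).symm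

end Complex

end Literature.AlgebraicGeometry.HodgeTheory

end
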